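import Summits.QuantumFields.YangMills.Theorems.BalabanUVNodesN19CoreMetric
import Literature.MathematicalPhysics.QuantumFieldTheory.Balaban1983to89.T4MatchingClosureSocket

/-!
# YM-DAG node N19 (= NE7 proper) — THE HYBRID CHAIN RULE: the WHOLE hybrid binder list `HybridNE7` COMPOSES across an
# intermediate run (re-keying calculus, part V: composition; parts I–IV = descent p593255 · ascent p601591 · tower p604222 · absorption p610409)

Cell `pub-ymgap`, HUMAN RULING D-0062 (Track A) + D-0149 (width seats, director-ym №197), WIDTH SEAT `pub-ymgap-dag-n19-w1` (N19 NE7, seat 1 of 3),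
generation g6; bus CLAIM-1 (HOME `INBOX.md` l.38726).  Route `Summits/QuantumFields/YangMills/Theses/BalabanUVNodes.lean`, key item K3⁸
«SpineGivenEndpointR13SepCoPHV» (stmt-QuantumFields-27366; KEY MAP v2 — K3⁷ stmt-QuantumFields-20544 is the aside lineage); filed `--kind proof --supports`
that item `--as helper` (it proves no registered stub).  COUNT-NEUTRAL.  THEOREMS ONLY; 0 `def`; 0 `sorry`; standard axioms.

THE POINT (numbers, not adjectives).  The tree composes NE7's TERM-WISE half across an intermediate core family — dag-n19-e's
`N19CoreMetric.core_trans` ∕ `core_trans_union` ∕ `coreEdge_trans` (`Core P M δ₁ → Core M Q δ₂ → Core P Q (δ₁ + δ₂)`, bad classes united) and the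
reading `s_N19_of_twoLegReading` (ONE bad class for both legs, NO weights) — but nothing composes the WEIGHT halves: given the binder lists of two legs
`A → M` (bad classes `Bad₁`, bad weight `W₁`, shells `shA ∕ shM` at `Wsh₁`, radius `δ₁`) and `M → B` (`Bad₂`, `W₂`, `shM ∕ shB`, `Wsh₂`, `δ₂`), the composed
pair `(A, B)` must carry NE7b on `Bad₁ ∪ Bad₂`, i.e. a bound for the mass of the FAR leg's bad class `Bad₂` under the NEAR run `A`, which neither leg
states.  It is TRANSPORTED (§1, one level, finite sums): `Bad₂ ∖ Bad₁` is GOOD for leg 1, so there `A − shA ≤ e^{−c₁ + vol·δ₁}(M − shM)`, whence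
`Σ_{Bad₂∖Bad₁} A ≤ e^{vol·δ₁ − c₁}·Σ_{Bad₂} M + Σ shA ≤ e^{vol·δ₁ − c₁}·W₂·Σ M + Wsh₁·Σ A`; and the middle run's TOTAL is the near run's up to the
sandwich and the lost mass, `(1 − W₁ − Wsh₁)·Σ M ≤ e^{c₁ + vol·δ₁}·Σ A` (`total_mid_le`).  Hence (`sum_union_le_transport`)
`Σ_{Bad₁ ∪ Bad₂} A ≤ (W₁ + Wsh₁ + e^{2·vol·δ₁}·W₂ ∕ (1 − W₁ − Wsh₁))·Σ A`, and symmetrically on the `B` side through leg 2 reversed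
(`N19CoreMetric.core_symm`).  The composed bad weight (§2, the `max` of the two sides) is SUMMABLE — summable times eventually bounded
(`summable_transportedWeight`: `δ₁ → 0` and `W₁ + Wsh₁ → 0`, so the distortion `e^{2volδ₁}∕(1 − W₁ − Wsh₁)` is eventually `≤ 2e`) — but `< 1` only
EVENTUALLY; so the honest conclusion is the kernel's FROM-`K₀`-ON currency (§3 `hybridNE7_trans`: `∃ K₀, HybridNE7` of the `K₀`-shifted composed data — the
shape of `T4MatchingClosureSocket.hybridNE7_closure'_tail` and of `T4MatchingAssembly.HybridNE7.matchingModConstants_tail`'s input), next to the unshifted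
edition under an explicit all-levels smallness binder (§2 `hybridNE7_trans_of_lt_one`).  §4 is the ∃-currency: «match modulo constants in the hybrid
sense, from some level on» is TRANSITIVE (`hybridNE7Edge_trans`).

READING (located; nothing proposed).  Any route that compares run A with run B THROUGH an intermediate family carrying its OWN bad classes and
weights — the H1L route's re-blocked run A⁺ (`Spine/NE7/Targets` §3), a window-truncated pair (this seat's g4 `…N19WindowTruncationKey` ∕
`…N19OneDatumTwoKeys`), or a chain of partial resummations — composes leg by leg in the binder-list currency at the price: radii ADD, shell weights
ADD, bad weights add up to the distortion `e^{2·vol·δ}∕(1 − W − Wsh)` of the leg they are transported across, and the level origin moves to where the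
composed weight drops below `1`.  In g5's canonical form (p630231 `exists_bad_hybridNE7_iff`: the N19′ ∧ N20 pair is ONE two-run tail letter on the
log-ratio deviation) this is the triangle inequality of that tail letter — violators of the composed sandwich lie in the union of the legs' violators,
and their masses are transported as above.

WHAT IS KERNEL-CHECKED ([folklore] finite sums ∕ real series; [bookkeeping] = tree theorems BY NAME).
* §1 ONE LEVEL (finite `T`, `Bad ⊆ T`, any `S ⊆ T`, near ∕ middle weights `a ∕ m` with shells `sa ∕ sm`, a sandwich `e^{c ∓ r}(a − sa) ≶ (m − sm)` off
  `Bad`): `total_mid_le` · `sum_sdiff_le_of_sandwich` · ★ `sum_union_le_transport`.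
* §2 THE LEGS (abstract carriers `T`, runs `A M B`, shells `shA shM shB`): `sum_badUnion_left_le` ∕ `sum_badUnion_right_le` (NE7b's two inequalities for
  the composed pair, per level) · `summable_transportedWeight` · `summable_transWeight` · `shellWeightBound_trans` (NE7c composes free, weight
  `Wsh₁ + Wsh₂`) · `relWeightBound_trans_of_lt_one` · ★★ `hybridNE7_trans_of_lt_one` (the complete composed binder list on `Bad₁ ∪ Bad₂`, radius
  `δ₁ + δ₂`, `core_trans_union` BY NAME, under the all-levels binder `W + (Wsh₁ + Wsh₂) < 1`).
* §3 FROM `K₀` ON: `hybridNE7_shift` · ★★★ `hybridNE7_trans` (NO smallness binder: `∃ K₀`, the composed binder list of the `K₀`-shifted data).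
* §4 THE ∃-CURRENCY: ★★ `hybridNE7Edge_trans` (legs in `∃ Bad W Wsh δ` form, middle shell shared ⇒ `∃ K₀ Bad W Wsh δ` for the shifted pair `(A, B)`,
  end shells `shA ∕ shB` kept; shell-free legs give a shell-free composite by instantiation).
* §5 THE DISTORTION IS REAL: `transport_twoPoint` — one level, `a = (1, 1)`, `m = (e^{r}, e^{−r})` (exact sandwich of radius `r`), `S` = the light point
  of `m`: its `a`-fraction is its `m`-fraction times `(1 + e^{2r})∕2 > 1` — a transported bad weight IS inflated by a radius-dependent factor.

HONEST FRAMING.  NE7 ∕ NE7b ∕ NE7c are NOT PRINTED as two-run statements for d = 4 ([Balaban1987RG1]–[Balaban1989LargeFieldII] bound ONE run uniformly in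
`ε`; printed template [King1986] (3.10)–(3.13) pp. 656–657, context only) and NOT PROVED; the three term families `A M B`, their shells, bad classes, weights
and radii are ABSTRACT and every leg is a HYPOTHESIS; nothing of Bałaban's is asserted or instantiated; N19 ∕ N20 ∕ N21 are NOT discharged; K3⁸ OPEN, «v6»
untouched; Track A counts UNMOVED (typed 28∕28 · discharged 5∕27).  One finite four-torus at fixed ε, rung (B)+1: R4 closes the conditional finite-𝕋⁴ rung
`BalabanLadder.UV` only — NOT infinite volume, NOT OS on ℝ⁴, NOT a mass gap; the YM mass gap (Clay) is NOT proved by any of this.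
-/

set_option autoImplicit false

noncomputable section

open Finset Filter Topology
open scoped BigOperators

namespace Summit.QuantumFields.YangMills.BalabanUVNodes.N19HybridChainRule

open Literature.MathematicalPhysics.QuantumFieldTheory.Balaban1983to89
open T4WeightBudget (RelWeightBound)
open T4IndicatorShell (ShellWeightBound)
open T4MatchingAssembly (HybridNE7 hybridNE7_of_relWeightBound)
open T4MatchingClosure (eventually_budget_lt_one)
open T4MatchingClosureSocket (relWeightBound_shift shellWeightBound_shift)
open Summit.QuantumFields.BalabanUV.T4Continuum.Spine
open Summit.QuantumFields.YangMills.BalabanUVNodes.N19CoreMetric (core_trans_union core_symm)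

/-! ## §1 One level: transporting a mass bound across a sandwich leg [folklore] -/

section OneLevel

variable {ι : Type*} [DecidableEq ι] {T Bad S : Finset ι} {a m sa sm : ι → ℝ} {c r W Wsh W' Wa Wsha : ℝ}

/-- **THE MIDDLE RUN'S TOTAL BY THE NEAR RUN'S** [folklore].  Off the bad set the middle cores are at most `e^{c + r}` times the near cores; the bad set
carries at most the fraction `W` and the shells at most the fraction `Wsh` of the middle total; shells lie between `0` and the term.  Then
`(1 − W − Wsh)·Σ_T m ≤ e^{c + r}·Σ_T a`. -/
theorem total_mid_le (hBad : Bad ⊆ T) (hhi : ∀ τ ∈ T \ Bad, m τ - sm τ ≤ Real.exp (c + r) * (a τ - sa τ))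
    (hsa0 : ∀ τ ∈ T, 0 ≤ sa τ) (hsa : ∀ τ ∈ T, sa τ ≤ a τ) (hsm0 : ∀ τ ∈ T, 0 ≤ sm τ)
    (hbadm : ∑ τ ∈ Bad, m τ ≤ W * ∑ τ ∈ T, m τ) (hshm : ∑ τ ∈ T, sm τ ≤ Wsh * ∑ τ ∈ T, m τ) :
    (1 - W - Wsh) * ∑ τ ∈ T, m τ ≤ Real.exp (c + r) * ∑ τ ∈ T, a τ := by
  have hsplit : ∑ τ ∈ T, m τ = ∑ τ ∈ Bad, m τ + ∑ τ ∈ T \ Bad, m τ := by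
    rw [← Finset.sum_sdiff hBad, add_comm]
  have hgood : ∑ τ ∈ T \ Bad, m τ = ∑ τ ∈ T \ Bad, (m τ - sm τ) + ∑ τ ∈ T \ Bad, sm τ := by
    rw [← Finset.sum_add_distrib]
    simp only [sub_add_cancel]
  have h1 : ∑ τ ∈ T \ Bad, (m τ - sm τ) ≤ Real.exp (c + r) * ∑ τ ∈ T, a τ := by
    calc ∑ τ ∈ T \ Bad, (m τ - sm τ) ≤ ∑ τ ∈ T \ Bad, Real.exp (c + r) * (a τ - sa τ) := Finset.sum_le_sum hhi
      _ = Real.exp (c + r) * ∑ τ ∈ T \ Bad, (a τ - sa τ) := by rw [Finset.mul_sum]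
      _ ≤ Real.exp (c + r) * ∑ τ ∈ T, a τ := by
        refine mul_le_mul_of_nonneg_left ?_ (Real.exp_pos _).le
        calc ∑ τ ∈ T \ Bad, (a τ - sa τ) ≤ ∑ τ ∈ T \ Bad, a τ :=
              Finset.sum_le_sum fun τ hτ => sub_le_self _ (hsa0 τ (Finset.mem_sdiff.mp hτ).1)
          _ ≤ ∑ τ ∈ T, a τ := Finset.sum_le_sum_of_subset_of_nonneg Finset.sdiff_subset
              fun τ hτ _ => (hsa0 τ hτ).trans (hsa τ hτ)
  have h2 : ∑ τ ∈ T \ Bad, sm τ ≤ Wsh * ∑ τ ∈ T, m τ :=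
    (Finset.sum_le_sum_of_subset_of_nonneg Finset.sdiff_subset fun τ hτ _ => hsm0 τ hτ).trans hshm
  have h3 : ∑ τ ∈ T, m τ ≤ W * ∑ τ ∈ T, m τ + Real.exp (c + r) * ∑ τ ∈ T, a τ + Wsh * ∑ τ ∈ T, m τ := by
    linarith [hsplit, hgood]
  linarith

/-- **A FAR SET'S NEAR-RUN MASS BY ITS MIDDLE-RUN MASS** [folklore].  Off the bad set the near cores are at most `e^{r − c}` times the middle cores
(`e^{c − r}(a − sa) ≤ m − sm`); shells lie between `0` and the term.  Then for any `S ⊆ T`: `Σ_{S ∖ Bad} a ≤ e^{r − c}·Σ_S m + Σ_T sa`. -/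
theorem sum_sdiff_le_of_sandwich (hST : S ⊆ T) (hlo : ∀ τ ∈ T \ Bad, Real.exp (c - r) * (a τ - sa τ) ≤ m τ - sm τ)
    (hsa0 : ∀ τ ∈ T, 0 ≤ sa τ) (hsm0 : ∀ τ ∈ T, 0 ≤ sm τ) (hsm : ∀ τ ∈ T, sm τ ≤ m τ) :
    ∑ τ ∈ S \ Bad, a τ ≤ Real.exp (r - c) * ∑ τ ∈ S, m τ + ∑ τ ∈ T, sa τ := by
  have hexp : Real.exp (r - c) * Real.exp (c - r) = 1 := by
    rw [← Real.exp_add]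
    simp
  have hpt : ∀ τ ∈ S \ Bad, a τ ≤ Real.exp (r - c) * m τ + sa τ := by
    intro τ hτ
    have hτS : τ ∈ S := (Finset.mem_sdiff.mp hτ).1
    have hτT : τ ∈ T := hST hτS
    have h := hlo τ (Finset.mem_sdiff.mpr ⟨hτT, (Finset.mem_sdiff.mp hτ).2⟩)
    have h' : a τ - sa τ ≤ Real.exp (r - c) * (m τ - sm τ) := by
      have h1 := mul_le_mul_of_nonneg_left h (Real.exp_pos (r - c)).le
      rwa [← mul_assoc, hexp, one_mul] at h1
    have h'' : Real.exp (r - c) * (m τ - sm τ) ≤ Real.exp (r - c) * m τ :=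
      mul_le_mul_of_nonneg_left (sub_le_self _ (hsm0 τ hτT)) (Real.exp_pos _).le
    linarith
  have hm0 : ∀ τ ∈ S, 0 ≤ m τ := fun τ hτ => (hsm0 τ (hST hτ)).trans (hsm τ (hST hτ))
  calc ∑ τ ∈ S \ Bad, a τ ≤ ∑ τ ∈ S \ Bad, (Real.exp (r - c) * m τ + sa τ) := Finset.sum_le_sum hpt
    _ = Real.exp (r - c) * ∑ τ ∈ S \ Bad, m τ + ∑ τ ∈ S \ Bad, sa τ := by
      rw [Finset.sum_add_distrib, Finset.mul_sum]
    _ ≤ Real.exp (r - c) * ∑ τ ∈ S, m τ + ∑ τ ∈ T, sa τ :=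
      add_le_add
        (mul_le_mul_of_nonneg_left (Finset.sum_le_sum_of_subset_of_nonneg Finset.sdiff_subset fun τ hτ _ => hm0 τ hτ)
          (Real.exp_pos _).le)
        (Finset.sum_le_sum_of_subset_of_nonneg (Finset.sdiff_subset.trans hST) fun τ hτ _ => hsa0 τ hτ)

/-- ★ **TRANSPORT OF A BAD WEIGHT ACROSS A SANDWICH LEG** [folklore].  Near run `a` (shell `sa`), middle run `m` (shell `sm`), a two-sided sandwich
`e^{c ∓ r}(a − sa) ≶ (m − sm)` off `Bad`, the bad set and the middle shells carrying the fractions `W`, `Wsh` of the middle total with `W + Wsh < 1`, the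
bad set and the near shells carrying the fractions `Wa`, `Wsha` of the near total, and a far set `S ⊆ T` carrying the fraction `W' ≥ 0` of the MIDDLE
total.  Then `S` together with `Bad` carries at most the fraction `Wa + Wsha + e^{2r}·W' ∕ (1 − W − Wsh)` of the NEAR total. -/
theorem sum_union_le_transport (hBad : Bad ⊆ T) (hST : S ⊆ T)
    (hlo : ∀ τ ∈ T \ Bad, Real.exp (c - r) * (a τ - sa τ) ≤ m τ - sm τ)
    (hhi : ∀ τ ∈ T \ Bad, m τ - sm τ ≤ Real.exp (c + r) * (a τ - sa τ))
    (hsa0 : ∀ τ ∈ T, 0 ≤ sa τ) (hsa : ∀ τ ∈ T, sa τ ≤ a τ) (hsm0 : ∀ τ ∈ T, 0 ≤ sm τ) (hsm : ∀ τ ∈ T, sm τ ≤ m τ)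
    (hbadm : ∑ τ ∈ Bad, m τ ≤ W * ∑ τ ∈ T, m τ) (hshm : ∑ τ ∈ T, sm τ ≤ Wsh * ∑ τ ∈ T, m τ) (hlt : W + Wsh < 1)
    (hSm : ∑ τ ∈ S, m τ ≤ W' * ∑ τ ∈ T, m τ) (hW' : 0 ≤ W')
    (hbada : ∑ τ ∈ Bad, a τ ≤ Wa * ∑ τ ∈ T, a τ) (hsha : ∑ τ ∈ T, sa τ ≤ Wsha * ∑ τ ∈ T, a τ) :
    ∑ τ ∈ Bad ∪ S, a τ ≤ (Wa + Wsha + Real.exp (2 * r) * W' / (1 - W - Wsh)) * ∑ τ ∈ T, a τ := by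
  have hunion : ∑ τ ∈ Bad ∪ S, a τ = ∑ τ ∈ Bad, a τ + ∑ τ ∈ S \ Bad, a τ := by
    rw [← Finset.union_sdiff_self_eq_union, Finset.sum_union Finset.disjoint_sdiff]
  have htot := total_mid_le hBad hhi hsa0 hsa hsm0 hbadm hshm
  have hfar := sum_sdiff_le_of_sandwich hST hlo hsa0 hsm0 hsm
  have hpos : 0 < 1 - W - Wsh := by linarith
  have hTm : ∑ τ ∈ T, m τ ≤ Real.exp (c + r) / (1 - W - Wsh) * ∑ τ ∈ T, a τ := by
    rw [div_mul_eq_mul_div, le_div_iff₀ hpos]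
    linarith
  have e2 : Real.exp (r - c) * Real.exp (c + r) = Real.exp (2 * r) := by
    rw [← Real.exp_add]
    congr 1
    ring
  have hkey : Real.exp (r - c) * ∑ τ ∈ S, m τ ≤ Real.exp (2 * r) * W' / (1 - W - Wsh) * ∑ τ ∈ T, a τ :=
    calc Real.exp (r - c) * ∑ τ ∈ S, m τ ≤ Real.exp (r - c) * (W' * ∑ τ ∈ T, m τ) :=
          mul_le_mul_of_nonneg_left hSm (Real.exp_pos _).le
      _ ≤ Real.exp (r - c) * (W' * (Real.exp (c + r) / (1 - W - Wsh) * ∑ τ ∈ T, a τ)) :=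
          mul_le_mul_of_nonneg_left (mul_le_mul_of_nonneg_left hTm hW') (Real.exp_pos _).le
      _ = Real.exp (2 * r) * W' / (1 - W - Wsh) * ∑ τ ∈ T, a τ := by
          rw [← e2]
          ring
  rw [hunion]
  calc ∑ τ ∈ Bad, a τ + ∑ τ ∈ S \ Bad, a τ
      ≤ Wa * ∑ τ ∈ T, a τ + (Real.exp (2 * r) * W' / (1 - W - Wsh) * ∑ τ ∈ T, a τ + Wsha * ∑ τ ∈ T, a τ) :=
        add_le_add hbada (hfar.trans (add_le_add hkey hsha))
    _ = (Wa + Wsha + Real.exp (2 * r) * W' / (1 - W - Wsh)) * ∑ τ ∈ T, a τ := by ring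

end OneLevel

/-! ## §2 The legs: NE7b transported, NE7c free, NE7 proper by `core_trans_union` — the composed binder list under an all-levels smallness binder -/

section ChainRule

variable {ι : Type*} [DecidableEq ι] {l₀ vol : ℝ} {T : ℕ → Finset ι} {A M B shA shM shB : ℕ → ℝ → ι → ℝ}
  {Bad₁ Bad₂ : ℕ → ℝ → Finset ι} {W₁ W₂ Wsh₁ Wsh₂ δ₁ δ₂ : ℕ → ℝ}

/-- **NE7b FOR THE COMPOSED PAIR, NEAR SIDE** [folklore]: under the two legs, at every level and admissible source the united bad class carries at most
the fraction `W₁ + Wsh₁ + e^{2·vol·δ₁}·W₂ ∕ (1 − W₁ − Wsh₁)` of run `A`'s total (leg 2's bad weight transported across leg 1, `sum_union_le_transport`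
with leg 1's core constant). -/
theorem sum_badUnion_left_le (h₁ : HybridNE7 l₀ vol T A M Bad₁ W₁ shA shM Wsh₁ δ₁) (h₂ : HybridNE7 l₀ vol T M B Bad₂ W₂ shM shB Wsh₂ δ₂)
    (K : ℕ) (t : ℝ) (ht : |t| ≤ l₀) :
    ∑ τ ∈ Bad₁ K t ∪ Bad₂ K t, A K t τ ≤
      (W₁ K + Wsh₁ K + Real.exp (2 * (vol * δ₁ K)) * W₂ K / (1 - W₁ K - Wsh₁ K)) * ∑ τ ∈ T K, A K t τ := by
  obtain ⟨c, hc⟩ := h₁.core K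
  exact sum_union_le_transport (h₁.weight.bad_subset K t ht) (h₂.weight.bad_subset K t ht)
    (fun τ hτ => (hc t ht τ hτ).1) (fun τ hτ => (hc t ht τ hτ).2)
    (h₁.shell.sh_nonneg_left K t ht) (h₁.shell.sh_le_left K t ht) (h₁.shell.sh_nonneg_right K t ht)
    (h₁.shell.sh_le_right K t ht) (h₁.weight.bad_right K t ht) (h₁.shell.right K t ht) (h₁.lt_one K)
    (h₂.weight.bad_left K t ht) (h₂.weight.nonneg K) (h₁.weight.bad_left K t ht) (h₁.shell.left K t ht)

/-- **NE7b FOR THE COMPOSED PAIR, FAR SIDE** [folklore]: symmetrically (leg 2 reversed by `N19CoreMetric.core_symm`, leg 1's bad weight transported across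
it) the united bad class carries at most the fraction `W₂ + Wsh₂ + e^{2·vol·δ₂}·W₁ ∕ (1 − W₂ − Wsh₂)` of run `B`'s total. -/
theorem sum_badUnion_right_le (h₁ : HybridNE7 l₀ vol T A M Bad₁ W₁ shA shM Wsh₁ δ₁) (h₂ : HybridNE7 l₀ vol T M B Bad₂ W₂ shM shB Wsh₂ δ₂)
    (K : ℕ) (t : ℝ) (ht : |t| ≤ l₀) :
    ∑ τ ∈ Bad₁ K t ∪ Bad₂ K t, B K t τ ≤
      (W₂ K + Wsh₂ K + Real.exp (2 * (vol * δ₂ K)) * W₁ K / (1 - W₂ K - Wsh₂ K)) * ∑ τ ∈ T K, B K t τ := by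
  obtain ⟨c, hc⟩ := core_symm h₂.core K
  rw [Finset.union_comm]
  exact sum_union_le_transport (h₂.weight.bad_subset K t ht) (h₁.weight.bad_subset K t ht)
    (fun τ hτ => (hc t ht τ hτ).1) (fun τ hτ => (hc t ht τ hτ).2)
    (h₂.shell.sh_nonneg_right K t ht) (h₂.shell.sh_le_right K t ht) (h₂.shell.sh_nonneg_left K t ht)
    (h₂.shell.sh_le_left K t ht) (h₂.weight.bad_left K t ht) (h₂.shell.left K t ht) (h₂.lt_one K)
    (h₁.weight.bad_right K t ht) (h₁.weight.nonneg K) (h₂.weight.bad_right K t ht) (h₂.shell.right K t ht)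

/-- **THE TRANSPORTED WEIGHT IS SUMMABLE** [folklore]: `Σ_K e^{2·vol·δ₁ K}·W₂ K ∕ (1 − W₁ K − Wsh₁ K) < ∞` for summable `δ₁`, `W₂ ≥ 0` and summable
`W₁, Wsh₁` — the distortion `e^{2volδ₁}∕(1 − W₁ − Wsh₁)` is EVENTUALLY `≤ 2e` (`δ₁ → 0`, `W₁ + Wsh₁ → 0`), and summability is a tail property
(`Summable.of_norm_bounded_eventually_nat`; the finitely many levels before `W₁ + Wsh₁ ≤ ½` are immaterial, so no smallness binder is asked). -/
theorem summable_transportedWeight (hδ₁ : Summable δ₁) (hW₂ : Summable W₂) (hW₂0 : ∀ K, 0 ≤ W₂ K) (hW₁ : Summable W₁)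
    (hWsh₁ : Summable Wsh₁) : Summable fun K => Real.exp (2 * (vol * δ₁ K)) * W₂ K / (1 - W₁ K - Wsh₁ K) := by
  have hδ0 : Tendsto (fun K => 2 * (vol * δ₁ K)) atTop (𝓝 0) := by
    simpa using (hδ₁.tendsto_atTop_zero.const_mul vol).const_mul 2
  have hW0 : Tendsto (fun K => W₁ K + Wsh₁ K) atTop (𝓝 0) := by
    simpa using (hW₁.add hWsh₁).tendsto_atTop_zero
  have e1 : ∀ᶠ K in atTop, 2 * (vol * δ₁ K) ≤ 1 := hδ0.eventually (eventually_le_nhds one_pos)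
  have e2 : ∀ᶠ K in atTop, W₁ K + Wsh₁ K ≤ 1 / 2 := hW0.eventually (eventually_le_nhds (by norm_num))
  refine Summable.of_norm_bounded_eventually_nat (hW₂.mul_left (2 * Real.exp 1)) ?_
  filter_upwards [e1, e2] with K hK1 hK2
  have hden : 0 < 1 - W₁ K - Wsh₁ K := by linarith
  have hexp : Real.exp (2 * (vol * δ₁ K)) ≤ Real.exp 1 := Real.exp_le_exp.mpr hK1
  have hnn : 0 ≤ Real.exp (2 * (vol * δ₁ K)) * W₂ K / (1 - W₁ K - Wsh₁ K) :=
    div_nonneg (mul_nonneg (Real.exp_pos _).le (hW₂0 K)) hden.le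
  rw [Real.norm_eq_abs, abs_of_nonneg hnn, div_le_iff₀ hden]
  have heW : 0 ≤ Real.exp 1 * W₂ K := mul_nonneg (Real.exp_pos 1).le (hW₂0 K)
  nlinarith [hexp, hW₂0 K, heW, hK2]

/-- **THE COMPOSED BAD WEIGHT** (the `max` of the two sides) **IS NON-NEGATIVE AND SUMMABLE** [folklore] (`max ≤` sum for non-negative reals). -/
theorem summable_transWeight (h₁ : HybridNE7 l₀ vol T A M Bad₁ W₁ shA shM Wsh₁ δ₁) (h₂ : HybridNE7 l₀ vol T M B Bad₂ W₂ shM shB Wsh₂ δ₂) :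
    (∀ K, 0 ≤ max (W₁ K + Wsh₁ K + Real.exp (2 * (vol * δ₁ K)) * W₂ K / (1 - W₁ K - Wsh₁ K))
        (W₂ K + Wsh₂ K + Real.exp (2 * (vol * δ₂ K)) * W₁ K / (1 - W₂ K - Wsh₂ K))) ∧
      Summable fun K => max (W₁ K + Wsh₁ K + Real.exp (2 * (vol * δ₁ K)) * W₂ K / (1 - W₁ K - Wsh₁ K))
        (W₂ K + Wsh₂ K + Real.exp (2 * (vol * δ₂ K)) * W₁ K / (1 - W₂ K - Wsh₂ K)) := by
  have hlt₁ : ∀ K, W₁ K + Wsh₁ K < 1 := h₁.lt_one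
  have hlt₂ : ∀ K, W₂ K + Wsh₂ K < 1 := h₂.lt_one
  have hnn₁ : ∀ K, 0 ≤ W₁ K + Wsh₁ K + Real.exp (2 * (vol * δ₁ K)) * W₂ K / (1 - W₁ K - Wsh₁ K) := fun K =>
    add_nonneg (add_nonneg (h₁.weight.nonneg K) (h₁.shell.nonneg K))
      (div_nonneg (mul_nonneg (Real.exp_pos _).le (h₂.weight.nonneg K)) (by linarith [hlt₁ K]))
  have hnn₂ : ∀ K, 0 ≤ W₂ K + Wsh₂ K + Real.exp (2 * (vol * δ₂ K)) * W₁ K / (1 - W₂ K - Wsh₂ K) := fun K =>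
    add_nonneg (add_nonneg (h₂.weight.nonneg K) (h₂.shell.nonneg K))
      (div_nonneg (mul_nonneg (Real.exp_pos _).le (h₁.weight.nonneg K)) (by linarith [hlt₂ K]))
  have hs₁ : Summable fun K => W₁ K + Wsh₁ K + Real.exp (2 * (vol * δ₁ K)) * W₂ K / (1 - W₁ K - Wsh₁ K) :=
    (h₁.weight.summable.add h₁.shell.summable).add
      (summable_transportedWeight h₁.summable h₂.weight.summable h₂.weight.nonneg h₁.weight.summable h₁.shell.summable)
  have hs₂ : Summable fun K => W₂ K + Wsh₂ K + Real.exp (2 * (vol * δ₂ K)) * W₁ K / (1 - W₂ K - Wsh₂ K) :=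
    (h₂.weight.summable.add h₂.shell.summable).add
      (summable_transportedWeight h₂.summable h₁.weight.summable h₁.weight.nonneg h₂.weight.summable h₂.shell.summable)
  refine ⟨fun K => (hnn₁ K).trans (le_max_left _ _), ?_⟩
  exact Summable.of_nonneg_of_le (fun K => (hnn₁ K).trans (le_max_left _ _))
    (fun K => max_le_add_of_nonneg (hnn₁ K) (hnn₂ K)) (hs₁.add hs₂)

/-- **NE7c COMPOSES FREE** [folklore]: run `A`'s shell clauses from leg 1, run `B`'s from leg 2, shell weight `Wsh₁ + Wsh₂`. -/
theorem shellWeightBound_trans (h₁ : HybridNE7 l₀ vol T A M Bad₁ W₁ shA shM Wsh₁ δ₁) (h₂ : HybridNE7 l₀ vol T M B Bad₂ W₂ shM shB Wsh₂ δ₂) :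
    ShellWeightBound l₀ T A B shA shB fun K => Wsh₁ K + Wsh₂ K where
  nonneg K := add_nonneg (h₁.shell.nonneg K) (h₂.shell.nonneg K)
  summable := h₁.shell.summable.add h₂.shell.summable
  sh_nonneg_left := h₁.shell.sh_nonneg_left
  sh_le_left := h₁.shell.sh_le_left
  sh_nonneg_right := h₂.shell.sh_nonneg_right
  sh_le_right := h₂.shell.sh_le_right
  left K t ht := (h₁.shell.left K t ht).trans (mul_le_mul_of_nonneg_right (le_add_of_nonneg_right (h₂.shell.nonneg K))
    (Finset.sum_nonneg fun τ hτ => (h₁.shell.sh_nonneg_left K t ht τ hτ).trans (h₁.shell.sh_le_left K t ht τ hτ)))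
  right K t ht := (h₂.shell.right K t ht).trans (mul_le_mul_of_nonneg_right (le_add_of_nonneg_left (h₁.shell.nonneg K))
    (Finset.sum_nonneg fun τ hτ => (h₂.shell.sh_nonneg_right K t ht τ hτ).trans (h₂.shell.sh_le_right K t ht τ hτ)))

/-- **NE7b FOR THE COMPOSED PAIR** [folklore], under the all-levels smallness binder «composed weight `< 1`» (it holds EVENTUALLY for free, §3): bad class
`Bad₁ ∪ Bad₂`, weight the `max` of the two transported sides. -/
theorem relWeightBound_trans_of_lt_one (h₁ : HybridNE7 l₀ vol T A M Bad₁ W₁ shA shM Wsh₁ δ₁) (h₂ : HybridNE7 l₀ vol T M B Bad₂ W₂ shM shB Wsh₂ δ₂)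
    (hlt : ∀ K, max (W₁ K + Wsh₁ K + Real.exp (2 * (vol * δ₁ K)) * W₂ K / (1 - W₁ K - Wsh₁ K))
        (W₂ K + Wsh₂ K + Real.exp (2 * (vol * δ₂ K)) * W₁ K / (1 - W₂ K - Wsh₂ K)) < 1) :
    RelWeightBound l₀ T A B (fun K t => Bad₁ K t ∪ Bad₂ K t) fun K =>
      max (W₁ K + Wsh₁ K + Real.exp (2 * (vol * δ₁ K)) * W₂ K / (1 - W₁ K - Wsh₁ K))
        (W₂ K + Wsh₂ K + Real.exp (2 * (vol * δ₂ K)) * W₁ K / (1 - W₂ K - Wsh₂ K)) where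
  bad_subset K t ht := Finset.union_subset (h₁.weight.bad_subset K t ht) (h₂.weight.bad_subset K t ht)
  nonneg := (summable_transWeight h₁ h₂).1
  lt_one := hlt
  summable := (summable_transWeight h₁ h₂).2
  bad_left K t ht := (sum_badUnion_left_le h₁ h₂ K t ht).trans (mul_le_mul_of_nonneg_right (le_max_left _ _)
    (Finset.sum_nonneg fun τ hτ => (h₁.shell.sh_nonneg_left K t ht τ hτ).trans (h₁.shell.sh_le_left K t ht τ hτ)))
  bad_right K t ht := (sum_badUnion_right_le h₁ h₂ K t ht).trans (mul_le_mul_of_nonneg_right (le_max_right _ _)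
    (Finset.sum_nonneg fun τ hτ => (h₂.shell.sh_nonneg_right K t ht τ hτ).trans (h₂.shell.sh_le_right K t ht τ hτ)))

/-- ★★ **THE COMPOSED BINDER LIST UNDER AN ALL-LEVELS SMALLNESS BINDER** [folklore]: legs `A → M` and `M → B` (middle shell `shM` shared) and
«composed bad weight + `Wsh₁ + Wsh₂ < 1` at every level» ⇒ `HybridNE7` of `(A, B)` on `Bad₁ ∪ Bad₂`, weight the transported `max`, shells `shA ∕ shB` at
`Wsh₁ + Wsh₂`, radius `δ₁ + δ₂` — NE7 proper by dag-n19-e's `N19CoreMetric.core_trans_union` BY NAME. -/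
theorem hybridNE7_trans_of_lt_one (h₁ : HybridNE7 l₀ vol T A M Bad₁ W₁ shA shM Wsh₁ δ₁) (h₂ : HybridNE7 l₀ vol T M B Bad₂ W₂ shM shB Wsh₂ δ₂)
    (hlt : ∀ K, max (W₁ K + Wsh₁ K + Real.exp (2 * (vol * δ₁ K)) * W₂ K / (1 - W₁ K - Wsh₁ K))
        (W₂ K + Wsh₂ K + Real.exp (2 * (vol * δ₂ K)) * W₁ K / (1 - W₂ K - Wsh₂ K)) + (Wsh₁ K + Wsh₂ K) < 1) :
    HybridNE7 l₀ vol T A B (fun K t => Bad₁ K t ∪ Bad₂ K t)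
      (fun K => max (W₁ K + Wsh₁ K + Real.exp (2 * (vol * δ₁ K)) * W₂ K / (1 - W₁ K - Wsh₁ K))
        (W₂ K + Wsh₂ K + Real.exp (2 * (vol * δ₂ K)) * W₁ K / (1 - W₂ K - Wsh₂ K)))
      shA shB (fun K => Wsh₁ K + Wsh₂ K) fun K => δ₁ K + δ₂ K :=
  hybridNE7_of_relWeightBound
    (relWeightBound_trans_of_lt_one h₁ h₂ fun K => by linarith [hlt K, h₁.shell.nonneg K, h₂.shell.nonneg K])
    (shellWeightBound_trans h₁ h₂) hlt (h₁.summable.add h₂.summable) (core_trans_union h₁.core h₂.core)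

end ChainRule

/-! ## §3 From `K₀` on: the composed binder list with NO smallness binder -/

section Shift

variable {ι : Type*} [DecidableEq ι] {l₀ vol : ℝ} {T : ℕ → Finset ι} {A M B shA shM shB : ℕ → ℝ → ι → ℝ}
  {Bad Bad₁ Bad₂ : ℕ → ℝ → Finset ι} {W Wsh δ W₁ W₂ Wsh₁ Wsh₂ δ₁ δ₂ : ℕ → ℝ}

/-- [bookkeeping] The hybrid binder list is stable under the origin shift `K ↦ K₀ + K` (`T4MatchingClosureSocket.relWeightBound_shift` ∕
`shellWeightBound_shift` BY NAME; the other clauses are per level, the radius re-indexed by `Summable.comp_injective`). [folklore] -/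
theorem hybridNE7_shift (K₀ : ℕ) (h : HybridNE7 l₀ vol T A B Bad W shA shB Wsh δ) :
    HybridNE7 l₀ vol (fun K => T (K₀ + K)) (fun K => A (K₀ + K)) (fun K => B (K₀ + K)) (fun K => Bad (K₀ + K))
      (fun K => W (K₀ + K)) (fun K => shA (K₀ + K)) (fun K => shB (K₀ + K)) (fun K => Wsh (K₀ + K)) fun K => δ (K₀ + K) :=
  hybridNE7_of_relWeightBound (relWeightBound_shift K₀ h.weight) (shellWeightBound_shift K₀ h.shell) (fun K => h.lt_one (K₀ + K))
    (h.summable.comp_injective (add_right_injective K₀)) fun K => h.core (K₀ + K)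

/-- ★★★ **THE HYBRID CHAIN RULE** [folklore].  Two legs `HybridNE7 … A M Bad₁ W₁ shA shM Wsh₁ δ₁` and `HybridNE7 … M B Bad₂ W₂ shM shB Wsh₂ δ₂` on common
carriers (middle shell shared) ⇒ for some `K₀` the `K₀`-SHIFTED pair `(A, B)` carries the composed binder list: bad class `Bad₁ ∪ Bad₂`, bad weight the
transported `max`, shells `shA ∕ shB` at `Wsh₁ + Wsh₂`, radius `δ₁ + δ₂`.  NO smallness binder: the composed weights are summable (§2), hence `< 1` from some
`K₀` on (`T4MatchingClosure.eventually_budget_lt_one`), and §2 applies to the shifted legs.  This is the kernel's from-`K₀`-on currency (the shape consumed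
by `T4MatchingAssembly.HybridNE7.matchingModConstants_tail` ∕ produced by `T4MatchingClosureSocket.hybridNE7_closure'_tail`). -/
theorem hybridNE7_trans (h₁ : HybridNE7 l₀ vol T A M Bad₁ W₁ shA shM Wsh₁ δ₁) (h₂ : HybridNE7 l₀ vol T M B Bad₂ W₂ shM shB Wsh₂ δ₂) :
    ∃ K₀ : ℕ, HybridNE7 l₀ vol (fun K => T (K₀ + K)) (fun K => A (K₀ + K)) (fun K => B (K₀ + K))
      (fun K t => Bad₁ (K₀ + K) t ∪ Bad₂ (K₀ + K) t)
      (fun K => max (W₁ (K₀ + K) + Wsh₁ (K₀ + K) + Real.exp (2 * (vol * δ₁ (K₀ + K))) * W₂ (K₀ + K) / (1 - W₁ (K₀ + K) - Wsh₁ (K₀ + K)))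
        (W₂ (K₀ + K) + Wsh₂ (K₀ + K) + Real.exp (2 * (vol * δ₂ (K₀ + K))) * W₁ (K₀ + K) / (1 - W₂ (K₀ + K) - Wsh₂ (K₀ + K))))
      (fun K => shA (K₀ + K)) (fun K => shB (K₀ + K)) (fun K => Wsh₁ (K₀ + K) + Wsh₂ (K₀ + K))
      fun K => δ₁ (K₀ + K) + δ₂ (K₀ + K) := by
  obtain ⟨K₀, hK₀⟩ := eventually_budget_lt_one (summable_transWeight h₁ h₂).2 (h₁.shell.summable.add h₂.shell.summable)
  exact ⟨K₀, hybridNE7_trans_of_lt_one (hybridNE7_shift K₀ h₁) (hybridNE7_shift K₀ h₂) fun K => hK₀ (K₀ + K) (Nat.le_add_right K₀ K)⟩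

end Shift

/-! ## §4 The ∃-currency: «match modulo constants in the hybrid sense, from some level on» is transitive -/

section Edge

variable {ι : Type*} [DecidableEq ι] {l₀ vol : ℝ} {T : ℕ → Finset ι} {A M B shA shM shB : ℕ → ℝ → ι → ℝ}

/-- ★★ **TRANSITIVITY IN THE ∃-CURRENCY** [folklore]: if `A` matches `M` in the hybrid sense for SOME bad classes ∕ weights ∕ shell weight ∕ radius (middle
shell `shM`) and `M` matches `B` likewise (same middle shell), then from some level `K₀` on `A` matches `B` in the hybrid sense for some bad classes ∕
weights ∕ shell weight ∕ radius, with the end shells `shA ∕ shB` kept. -/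
theorem hybridNE7Edge_trans
    (h₁ : ∃ (Bad₁ : ℕ → ℝ → Finset ι) (W₁ Wsh₁ δ₁ : ℕ → ℝ), HybridNE7 l₀ vol T A M Bad₁ W₁ shA shM Wsh₁ δ₁)
    (h₂ : ∃ (Bad₂ : ℕ → ℝ → Finset ι) (W₂ Wsh₂ δ₂ : ℕ → ℝ), HybridNE7 l₀ vol T M B Bad₂ W₂ shM shB Wsh₂ δ₂) :
    ∃ (K₀ : ℕ) (Bad : ℕ → ℝ → Finset ι) (W Wsh δ : ℕ → ℝ),
      HybridNE7 l₀ vol (fun K => T (K₀ + K)) (fun K => A (K₀ + K)) (fun K => B (K₀ + K)) Bad W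
        (fun K => shA (K₀ + K)) (fun K => shB (K₀ + K)) Wsh δ := by
  obtain ⟨Bad₁, W₁, Wsh₁, δ₁, h₁⟩ := h₁
  obtain ⟨Bad₂, W₂, Wsh₂, δ₂, h₂⟩ := h₂
  obtain ⟨K₀, h⟩ := hybridNE7_trans h₁ h₂
  exact ⟨K₀, _, _, _, _, h⟩

end Edge

/-! ## §5 The distortion is real: a two-point datum [folklore] -/

section TwoPoint

/-- **A BAD WEIGHT TRANSPORTED ACROSS A LEG OF RADIUS `r` IS INFLATED BY UP TO `(1 + e^{2r}) ∕ 2`** [folklore].  One level, two points, no shells, no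
bad class on the leg: near weights `a = (1, 1)`, middle weights `m = (e^{r}, e^{−r})` — an exact two-sided sandwich of radius `r` about `c = 0`; the far set
`S = {1}` (the light point of `m`) has `m`-fraction `W' = e^{−r} ∕ (e^{r} + e^{−r})` and `a`-fraction `½ = W'·(1 + e^{2r}) ∕ 2`, STRICTLY above `W'` for
`r > 0`: the `e^{2r}`-type distortion of `sum_union_le_transport` cannot be replaced by `1`. -/
theorem transport_twoPoint {r : ℝ} (hr : 0 < r) :
    let a : Fin 2 → ℝ := fun _ => 1
    let m : Fin 2 → ℝ := fun i => if i = 0 then Real.exp r else Real.exp (-r)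
    let W' : ℝ := Real.exp (-r) / (Real.exp r + Real.exp (-r))
    (∀ i : Fin 2, Real.exp (0 - r) * a i ≤ m i ∧ m i ≤ Real.exp (0 + r) * a i) ∧
      ∑ i ∈ ({1} : Finset (Fin 2)), m i = W' * ∑ i ∈ (Finset.univ : Finset (Fin 2)), m i ∧
      ∑ i ∈ ({1} : Finset (Fin 2)), a i = W' * ((1 + Real.exp (2 * r)) / 2) * ∑ i ∈ (Finset.univ : Finset (Fin 2)), a i ∧
      W' * ∑ i ∈ (Finset.univ : Finset (Fin 2)), a i < ∑ i ∈ ({1} : Finset (Fin 2)), a i := by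
  have h1 : Real.exp (-r) ≤ Real.exp r := Real.exp_le_exp.mpr (by linarith)
  have hpos : 0 < Real.exp r + Real.exp (-r) := add_pos (Real.exp_pos _) (Real.exp_pos _)
  have hprod : Real.exp r * Real.exp (-r) = 1 := by rw [← Real.exp_add]; simp
  have h2r : Real.exp (2 * r) = Real.exp r * Real.exp r := by rw [← Real.exp_add]; ring_nf
  refine ⟨fun i => ?_, ?_, ?_, ?_⟩
  · fin_cases i
    · simp only [zero_sub, mul_one, Fin.isValue, zero_add]
      exact ⟨h1, le_rfl⟩
    · simp only [zero_sub, mul_one, Fin.isValue, zero_add]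
      exact ⟨le_rfl, h1⟩
  · simp only [Fin.sum_univ_two, Fin.isValue, Finset.sum_singleton, one_ne_zero, ↓reduceIte]
    rw [div_mul_cancel₀ _ hpos.ne']
  · simp only [Fin.sum_univ_two, Finset.sum_singleton]
    rw [h2r]
    field_simp
    nlinarith [hprod, Real.exp_pos r, Real.exp_pos (-r)]
  · simp only [Fin.sum_univ_two, Finset.sum_singleton]
    rw [div_mul_eq_mul_div, div_lt_iff₀ hpos]
    have hlt : Real.exp (-r) < Real.exp r := Real.exp_lt_exp.mpr (by linarith)
    linarith

end TwoPoint

end Summit.QuantumFields.YangMills.BalabanUVNodes.N19HybridChainRule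

end
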